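import Mathlib
import Literature.NumberTheory.Automorphic.HilbertModularFormQExpansion

/-!
# Uniqueness of holomorphic functions on `ℍ^d` from the imaginary orthant
(stub stub_imaginary_orthant_identity of line Sketch-ideate-r1-k1)

Stub V4 of the crux `HilbertIntegralOverconvergentIsCongruence` (stmt-Langlands-8485): two functions
`f`, `g` holomorphic on the product of upper half planes `ℍ = halfSpace F ⊆ Point F = ℂ^{Hom(F,ℝ)}`
which agree at every purely imaginary point `iy`, `y ≫ 0`, agree on all of `ℍ`.  This propagates the
theta inversion formula from the imaginary orthant (where it is Hecke's computation) to `ℍ`.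

Proof: one variable at a time.  For a finite set `S` of real embeddings let `P(S)` be the statement
"`f z = g z` for every `z ∈ ℍ` whose coordinates off `S` are purely imaginary".  `P(∅)` is the
hypothesis.  For `P(S) ⇒ P(insert σ₀ S)` fix such a `z` and restrict to the complex line
`t ↦ Function.update z σ₀ t`: the two restrictions are holomorphic on the upper half plane
`{t | 0 < Im t}` (open, convex hence preconnected) and agree at `t = ir`, `r > 0`, by `P(S)`; these
points accumulate at `i`, so the one-variable identity theorem
(`AnalyticOnNhd.eqOn_of_preconnected_of_frequently_eq`) makes them agree on the whole upper half
plane, in particular at `t = z_{σ₀}`, where the line passes through `z`.  Conclude with `S = univ`.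
-/

set_option linter.dupNamespace false

noncomputable section

namespace Summit.Langlands.Langlands.Theorems.HilbertIntegralOverconvergentIsCongruence

open MeasureTheory Complex NumberField
open Literature.NumberTheory.Automorphic Literature.NumberTheory.Automorphic.HilbertModular
open scoped MatrixGroups
open Filter Topology Set

/-- Moving one coordinate of a point of `ℍ` to another point of the upper half plane stays in `ℍ`.
[folklore] -/
theorem ioi_update_mem_halfSpace {F : Type} [Field F] [DecidableEq (F →+* ℝ)] {z : Point F}
    (hz : z ∈ halfSpace F) (σ₀ : F →+* ℝ) {t : ℂ} (ht : 0 < t.im) :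
    Function.update z σ₀ t ∈ halfSpace F := by
  refine mem_halfSpace_iff.2 fun σ ↦ ?_
  rcases eq_or_ne σ σ₀ with rfl | hne
  · simpa using ht
  · rw [Function.update_of_ne hne]
    exact mem_halfSpace_iff.1 hz σ

/-- The restriction of a function holomorphic on `ℍ` to the complex line through `z ∈ ℍ` in the
`σ₀`-th coordinate direction is holomorphic on the upper half plane `{t | 0 < Im t}` (chain rule with
the affine map `t ↦ Function.update z σ₀ t`). [folklore] -/
theorem ioi_differentiableOn_line {F : Type} [Field F] [NumberField F] [DecidableEq (F →+* ℝ)]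
    {u : Point F → ℂ} (hu : IsHolomorphicOn F u) {z : Point F} (hz : z ∈ halfSpace F)
    (σ₀ : F →+* ℝ) :
    DifferentiableOn ℂ (fun t : ℂ ↦ u (Function.update z σ₀ t)) {t : ℂ | 0 < t.im} :=
  hu.comp (fun t _ ↦ (hasDerivAt_update z σ₀ t).differentiableAt.differentiableWithinAt)
    fun _ ht ↦ ioi_update_mem_halfSpace hz σ₀ ht

/-- The positive imaginary axis accumulates at `i`: a property holding at all points `ir`, `r > 0`,
holds frequently on punctured neighbourhoods of `i` (push forward `𝓝[≠] 1` on `ℝ` along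
`r ↦ ir`). [folklore] -/
theorem ioi_frequently_imaginary {p : ℂ → Prop} (hp : ∀ r : ℝ, 0 < r → p ((r : ℂ) * I)) :
    ∃ᶠ t in 𝓝[≠] I, p t := by
  have hev : ∀ᶠ r : ℝ in 𝓝[≠] 1, p ((r : ℂ) * I) := by
    have h1 : ∀ᶠ r : ℝ in 𝓝 1, 0 < r := eventually_gt_nhds one_pos
    filter_upwards [nhdsWithin_le_nhds h1] with r hr
    exact hp r hr
  have htend : Tendsto (fun r : ℝ ↦ (r : ℂ) * I) (𝓝[≠] 1) (𝓝[≠] I) := by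
    have hc : ContinuousWithinAt (fun r : ℝ ↦ (r : ℂ) * I) {1}ᶜ 1 :=
      (Complex.continuous_ofReal.mul continuous_const).continuousWithinAt
    have hmaps : MapsTo (fun r : ℝ ↦ (r : ℂ) * I) {1}ᶜ {I}ᶜ := fun r hr hrI ↦ hr <| by
      have him := congrArg Complex.im (Set.mem_singleton_iff.1 hrI)
      simpa using him
    simpa using hc.tendsto_nhdsWithin hmaps
  exact htend.frequently hev.frequently

/-- **One-variable identity theorem on the upper half plane, imaginary-axis form.** Two functions
holomorphic on `{t | 0 < Im t}` which agree at `ir` for every `r > 0` agree on the whole upper half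
plane: it is open and convex, hence preconnected, holomorphic functions on it are analytic, and the
coincidence set accumulates at `i`. [folklore] -/
theorem ioi_line_identity {u v : ℂ → ℂ} (hu : DifferentiableOn ℂ u {t : ℂ | 0 < t.im})
    (hv : DifferentiableOn ℂ v {t : ℂ | 0 < t.im})
    (huv : ∀ r : ℝ, 0 < r → u ((r : ℂ) * I) = v ((r : ℂ) * I)) {t : ℂ} (ht : 0 < t.im) :
    u t = v t := by
  have hU : IsOpen {t : ℂ | 0 < t.im} := isOpen_lt continuous_const Complex.continuous_im
  have hpre : IsPreconnected {t : ℂ | 0 < t.im} := (convex_halfSpace_im_gt 0).isPreconnected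
  have hI : I ∈ {t : ℂ | 0 < t.im} := by simp
  exact (hu.analyticOnNhd hU).eqOn_of_preconnected_of_frequently_eq (hv.analyticOnNhd hU) hpre hI
    (ioi_frequently_imaginary huv) ht

/-- **stub V4 — `stub_imaginary_orthant_identity` (M; uniqueness from the imaginary orthant).** Two holomorphic functions on `ℍ^d`
that agree at every purely imaginary point `iy`, `y ≫ 0`, agree on `ℍ^d`: one variable at a time — for fixed imaginary values of the
other coordinates, `z_σ ↦ f - g` is holomorphic on the upper half plane and vanishes on `iℝ_+`, which accumulates, so it vanishes
(Mathlib's one-variable identity theorem); induct on the set of coordinates already made complex. [folklore] -/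
theorem stub_imaginary_orthant_identity (F : Type) [Field F] [NumberField F] (f g : Point F → ℂ)
    (hf : IsHolomorphicOn F f) (hg : IsHolomorphicOn F g)
    (h : ∀ y : (F →+* ℝ) → ℝ, (∀ σ, 0 < y σ) → f (fun σ ↦ ((y σ : ℝ) : ℂ) * I) = g (fun σ ↦ ((y σ : ℝ) : ℂ) * I)) :
    ∀ z ∈ halfSpace F, f z = g z := by
  classical
  -- `P(S)`: agreement at the points of `ℍ` whose coordinates off `S` are purely imaginary
  suffices key : ∀ S : Finset (F →+* ℝ), ∀ z ∈ halfSpace F,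
      (∀ σ, σ ∉ S → (z σ).re = 0) → f z = g z from
    fun z hz ↦ key Finset.univ z hz fun σ hσ ↦ absurd (Finset.mem_univ σ) hσ
  intro S
  induction S using Finset.induction_on with
  | empty =>
    intro z hz hre
    have hzeq : z = fun σ ↦ (((z σ).im : ℝ) : ℂ) * I := by
      funext σ
      apply Complex.ext
      · simp [hre σ (Finset.notMem_empty σ)]
      · simp
    rw [hzeq]
    exact h (fun σ ↦ (z σ).im) (mem_halfSpace_iff.1 hz)
  | insert σ₀ S _ ih =>
    intro z hz hre
    -- agreement along the positive imaginary axis of the `σ₀`-line through `z`, by `P(S)`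
    have hline : ∀ r : ℝ, 0 < r →
        f (Function.update z σ₀ ((r : ℂ) * I)) = g (Function.update z σ₀ ((r : ℂ) * I)) := by
      intro r hr
      have hrI : 0 < ((r : ℂ) * I).im := by simpa using hr
      refine ih _ (ioi_update_mem_halfSpace hz σ₀ hrI) fun σ hσ ↦ ?_
      rcases eq_or_ne σ σ₀ with rfl | hne
      · simp
      · rw [Function.update_of_ne hne]
        exact hre σ fun hmem ↦ (Finset.mem_insert.1 hmem).elim hne hσ
    -- one-variable identity theorem on the `σ₀`-line, evaluated at `t = z σ₀`
    have key := ioi_line_identity (ioi_differentiableOn_line hf hz σ₀)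
      (ioi_differentiableOn_line hg hz σ₀) hline (mem_halfSpace_iff.1 hz σ₀)
    simpa using key

end Summit.Langlands.Langlands.Theorems.HilbertIntegralOverconvergentIsCongruence
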